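import Summits.ResolutionOfSingularities.ResolutionOfSingularities.Theses.Valuative
import Literature.AlgebraicGeometry.Resolution.ResolutionOfComponents
import Literature.AlgebraicGeometry.Resolution.ZariskiPatchingAllDimensions
import Literature.AlgebraicGeometry.Resolution.BadCurveInduction
import Literature.AlgebraicGeometry.Resolution.ResolutionOfCurves
import Literature.Barriers.ResolutionOfSingularities.DimensionFourFrontier
import HarnessLib

/-!
# Crux `PatchingRel` (stmt-ResolutionOfSingularities-0642) — line `dimension-ladder`
# (forward generator G4 `ladder-down`, unit `fwd-ladder-ResolutionOfSingularities-50`, 2026-08-17)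

THE LADDER. The crux `Theses.Valuative.PatchingRel` is `∀ p prime, LUrel_p → ResolutionInChar p`
(relative local uniformization in characteristic `p` ⇒ resolution in characteristic `p`). In its
OWN language the one gradation parameter with a proved floor and an honest next rung is the
DIMENSION `n` of the schemes being resolved:

  `PatchingRelUpToDim n := ∀ p prime, LUrel_p → ∀ k (char p), ResolutionOverUpToDim k n`

(`Literature.AlgebraicGeometry.Resolution.ResolutionOverUpToDim`, `ArithmeticalThreefolds.lean`:
weak resolution of reduced separated `k`-schemes of finite type of `topologicalKrullDim ≤ n`).
The family is antitone in `n` (`PatchingRelUpToDim.mono`), the crux is its limit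
(`patchingRel_iff_forall` — schemes of finite type over a field are finite-dimensional,
`exists_topologicalKrullDim_le_of_locallyOfFiniteType`), and:

* rung `1` is a theorem of the tree, LU idle (`PatchingRelUpToDim.one`, `resolutionOverUpToDim_one`);
* rung `2` is the named fact `CossartJannsenSaito2020` (LU idle, `PatchingRelUpToDim.two`);
* rung `3` = THE FLOOR θ₀: `CossartPiltant2019` (Thm. 1.1; LU idle, `PatchingRelUpToDim.three`), and —
  the PATCHING floor, LU load-bearing — Cossart–Piltant's Prop. 4.6 = Zariski 1944 / Piltant 2013
  Prop. 5.1 + Cor. 5.7 in transcendence degree `3`: `CossartJannsenSaito2020 →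
  CossartPiltant2019Patching → PatchingRelUpToDim 3` (`PatchingRelUpToDim.three_of_patching`), with
  the patching PROVED in the tree from Cossart–Piltant's principalization on regular threefolds
  (`CossartPiltant2019Patching.of_principalization`, `BadCurveInduction.lean`):
  `PatchingRelUpToDim.three_of_principalization`;
* rung `4` = THE NEXT RUNG θ₁ = `stub_patchingRelUpToDim_four` (≡ the strategist's prepared split
  child `PatchingRelDimLeFour`, `patchingRelUpToDim_four_iff_dimLeFour`; `Cruxes/PatchingRel/
  SplitChildren.md`). Located stopping point of the floor's proof: the two-model patching
  (Piltant 2013 Prop. 5.1 for `P = P_reg`) is proved only in transcendence degree `3`, because its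
  domination step principalizes ideals on REGULAR THREEFOLDS with centres over the bad locus
  (Cossart–Piltant 2019 Prop. 4.4 = `CossartPiltant2019Principalization`) and resolves the
  embedded SURFACES met on the way (CJS 2020); in transcendence degree `4` the same step needs
  principalization on regular FOURFOLDS with regular centres confined over the indeterminacy locus
  and embedded resolution of THREEFOLDS in regular fourfolds in characteristic `p` — printed open
  (Piltant 2013 p. 2 and Problem 7.1; Cutkosky 2009 §1 "The patching argument of Step 4 also does
  not extend to higher dimensions"; `Literature/Barriers/ResolutionOfSingularities/
  DimensionFourFrontier.lean`). Given `CossartPiltant2019`, the rung is implied by Zariski patching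
  in dimension `4` over fields of characteristic `p` (`PatchingRelUpToDim.four_of_zariskiPatching`):
  the rung is the char-`p`, LU-granted form of the barrier file's isolated input
  `ZariskiPatchingUpToDim 4`.
* gap = `stub_patchingRelDimGeFive`: the INTEGRAL dimension-`≥ 5` slice (verbatim the strategist's
  `PatchingRelDimGeFive`). Integrality keeps it honest: it does not contain the rung (a reduced
  `X₄ ⊔ 𝔸⁵` would), and the cumulative `∀ n ≥ 5, PatchingRelUpToDim n` is NOT used as the gap
  because it implies the rung and the crux by monotonicity (costume).

Composition: the skeleton theorem `PatchingRel_of : Theses.Valuative.PatchingRel` applies the two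
stubs by name, and `patchingRel_of_rung_of_gap : ‹stub 1› → ‹stub 2› → Theses.Valuative.PatchingRel`
is the same composition sorry-free with the stubs as hypotheses (reduce `ResolutionInChar p` to
integral schemes, `resolutionInChar_iff_integral`, and split on `topologicalKrullDim X ≤ 4`; proof =
the strategist's `SplitGlue.lean`). On-path `PatchingRel → rung` is `PatchingRelUpToDim.of_patchingRel`;
`S → rung` is `PatchingRelUpToDim.of_resolutionOfSingularities` (F4: fine, the other end is pinned
to the proved floor `PatchingRelUpToDim.three`). Sorries: exactly the two `stub_*`.

KEYS (F2/F6): rung_decl = `Summit.ResolutionOfSingularities.ResolutionOfSingularities.Cruxes.PatchingRel.DimensionLadder.PatchingRelUpToDim`;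
witness = `…DimensionLadder.PatchingRelUpToDim.three` (CossartPiltant2019, Thm. 1.1) and, LU load-bearing,
`…PatchingRelUpToDim.three_of_principalization` (Piltant 2013 Prop. 5.1 + Cor. 5.7; Cossart–Piltant 2019 Prop. 4.4/4.6);
special_file = `Cruxes/PatchingRel/Lines/PatchingRelUpToDim4_special.lean` (no sorry); line card =
`Cruxes/PatchingRel/Lines/PatchingRelUpToDim4.md`; ladder = `Cruxes/PatchingRel/LADDER-PatchingRel.md`;
method_family = zariski-patching + regular-threefold principalization + CJS surfaces; ladder_ceiling = capped-at-dim3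
(Piltant 2013 p. 2, p. 3, Problem 7.1; Cutkosky 2009 §1; DimensionFourFrontier.lean); disposition = frontier;
witness_regime = dim ≤ 3 (S known there: yes); residual = none.
-/

set_option linter.dupNamespace false

noncomputable section

namespace Summit.ResolutionOfSingularities.ResolutionOfSingularities.Cruxes.PatchingRel.DimensionLadder

open CategoryTheory AlgebraicGeometry TopologicalSpace
open Literature.AlgebraicGeometry.Resolution
open Literature.Barriers.ResolutionOfSingularities
open Summit.ResolutionOfSingularities.ResolutionOfSingularities

/-! ## The crux antecedent and the rung family -/

/-- `LUrel_p`, the antecedent of the crux `PatchingRel`, verbatim: relative local uniformization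
of every valuation ring of every finitely generated field extension `K/k`, `char k = p`.
[this project, Theses/Valuative.lean `PatchingRel`] -/
def LUrel (p : ℕ) : Prop :=
  ∀ (k K : Type) [Field k] [CharP k p] [Field K] [Algebra k K], (⊤ : IntermediateField k K).FG →
    ∀ O : ValuationSubring K, (∀ c : k, algebraMap k K c ∈ O) → ∀ R : Subalgebra k K, R.FG →
      R.toSubring ≤ O.toSubring → ∃ (A : Subalgebra k K) (h : A.toSubring ≤ O.toSubring),
        R ≤ A ∧ A.FG ∧ IsFractionRing A K ∧ IsRegularLocalRing (Localization.AtPrime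
          (Ideal.comap (Subring.inclusion h) (IsLocalRing.maximalIdeal O)))

/-- The crux is literally `∀ p prime, LUrel p → ResolutionInChar p`. [folklore] -/
theorem patchingRel_iff_lurel :
    Theses.Valuative.PatchingRel ↔ ∀ p : ℕ, p.Prime → LUrel p → ResolutionInChar.{0} p :=
  Iff.rfl

/-- **The dimension ladder of the crux.** Rung `n`: relative local uniformization in
characteristic `p` implies weak resolution of reduced separated schemes of finite type of
dimension `≤ n` over every field of characteristic `p`. [folklore] -/
def PatchingRelUpToDim (n : ℕ) : Prop :=
  ∀ p : ℕ, p.Prime → LUrel p → ∀ (k : Type) [Field k] [CharP k p], ResolutionOverUpToDim.{0} k n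

/-- The ladder is antitone in the dimension. [folklore] -/
theorem PatchingRelUpToDim.mono {m n : ℕ} (hmn : m ≤ n) (h : PatchingRelUpToDim n) :
    PatchingRelUpToDim m :=
  fun p hp hLU k _ _ => (h p hp hLU k).mono hmn

/-- ON-PATH (`Crux → rung`): the crux gives every rung. [folklore] -/
theorem PatchingRelUpToDim.of_patchingRel (h : Theses.Valuative.PatchingRel) (n : ℕ) :
    PatchingRelUpToDim n :=
  fun p hp hLU k _ _ => resolutionOverUpToDim_of_resolutionInChar (h p hp hLU) k n

/-- F4 (`S → rung`, recorded): every rung is a consequence of the summit (the crux is `S`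
weakened by the extra hypothesis `LUrel_p`). [folklore] -/
theorem PatchingRelUpToDim.of_resolutionOfSingularities (hS : _root_.ResolutionOfSingularities)
    (n : ℕ) : PatchingRelUpToDim n :=
  fun p hp _ k _ _ => resolutionOverUpToDim_of_resolutionInChar (hS p hp) k n

/-! ## `LUrel_p` feeds the technique class of the barrier file -/

/-- `LUrel_p` gives local uniformization up to every dimension over every field of
characteristic `p` (`LocalUniformizationUpToDim`, the LU half of the technique class of
`DimensionFourFrontier.lean`): a finitely generated affine model `A ⊆ O` with `Frac A = K` makes
`K/k` finitely generated and `k ⊆ O`. Bookkeeping of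
`resolutionInChar_of_twoModelPatching_of_relLU`. [folklore] -/
theorem localUniformizationUpToDim_of_lurel {p : ℕ} (hLU : LUrel p) (k : Type) [Field k]
    [CharP k p] (n : ℕ) : LocalUniformizationUpToDim.{0} k n := by
  intro K _ _ O A hAO hAfg hAfr _
  haveI : Algebra.FiniteType k A := A.fg_iff_finiteType.mp hAfg
  haveI : IsFractionRing A K := hAfr
  haveI : Algebra.EssFiniteType A K :=
    Algebra.EssFiniteType.of_isLocalization K (nonZeroDivisors A)
  have hKfg : (⊤ : IntermediateField k K).FG :=
    IntermediateField.fg_top_iff.mpr (Algebra.EssFiniteType.comp k A K)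
  obtain ⟨A', h, hle, hA'fg, -, hreg⟩ :=
    hLU k K hKfg O (fun c => hAO (A.algebraMap_mem c)) A hAfg hAO
  exact ⟨A', h, hle, hA'fg, hreg⟩

/-! ## Proved rungs (the floor and below) -/

/-- Rung `1`, unconditionally (resolution of curves over any field; LU idle). [folklore] -/
theorem PatchingRelUpToDim.one : PatchingRelUpToDim 1 :=
  fun _ _ _ k _ _ => resolutionOverUpToDim_one k

/-- Rung `2` from resolution of excellent surfaces (LU idle).
[cite: CossartJannsenSaito2020, Thm. 1.2] -/
theorem PatchingRelUpToDim.two (hCJS : CossartJannsenSaito2020.{0}) : PatchingRelUpToDim 2 :=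
  fun _ _ _ k _ => hCJS k

/-- **THE FLOOR θ₀ = 3**, LU idle: Cossart–Piltant's resolution of threefolds over any field.
[cite: CossartPiltant2019, Thm. 1.1] -/
theorem PatchingRelUpToDim.three (h3 : CossartPiltant2019.{0}) : PatchingRelUpToDim 3 :=
  fun _ _ _ k _ => cossartPiltant2019_iff.mp h3 k

/-- **THE PATCHING FLOOR θ₀ = 3, LU load-bearing**: resolution of surfaces and Cossart–Piltant's
enhanced Zariski patching in dimension `3` turn `LUrel_p` into resolution up to dimension `3` in
characteristic `p`. [cite: CossartPiltant2019, Prop. 4.6 (arXiv v1: Prop. 4.4), patching] -/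
theorem PatchingRelUpToDim.three_of_patching (hCJS : CossartJannsenSaito2020.{0})
    (hP3 : CossartPiltant2019Patching.{0}) : PatchingRelUpToDim 3 :=
  fun _ _ hLU k _ _ => hP3 k (hCJS k)
    ((localUniformizationUpToDim_three_iff k).mp (localUniformizationUpToDim_of_lurel hLU k 3))

/-- The same with the patching PROVED in the tree from Cossart–Piltant's principalization on
regular threefolds (Zariski's compactness + Piltant's Prop. 5.1 by the bad-curve induction,
`CossartPiltant2019Patching.of_principalization`): the dimension-`3` rung of THIS line's method
family, modulo two dimension-`≤ 3` named facts. [cite: Piltant2013, Prop. 5.1 and Cor. 5.7]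
[cite: CossartPiltant2019, Prop. 4.4 (principalization) and Prop. 4.6 (patching)] -/
theorem PatchingRelUpToDim.three_of_principalization (hCJS : CossartJannsenSaito2020.{0})
    (hPr : CossartPiltant2019Principalization.{0}) : PatchingRelUpToDim 3 :=
  PatchingRelUpToDim.three_of_patching hCJS (CossartPiltant2019Patching.of_principalization hPr)

/-! ## The next rung θ₁ = 4 and the barrier file's isolated input -/

/-- **Rung `4` from Zariski patching in dimension `4` in characteristic `p`** (given the floor):
the rung is the characteristic-`p`, LU-granted form of `ZariskiPatchingUpToDim 4`, the input the
sources print as open. [cite: Piltant2013, p. 2 and Problem 7.1] [cite: Cutkosky2009, §1] -/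
theorem PatchingRelUpToDim.four_of_zariskiPatching (h3 : CossartPiltant2019.{0})
    (hP4 : ∀ p : ℕ, p.Prime → ∀ (k : Type) [Field k] [CharP k p],
      ResolutionOverUpToDim.{0} k 3 → LocalUniformizationUpToDim.{0} k 4 →
        ResolutionOverUpToDim.{0} k 4) :
    PatchingRelUpToDim 4 :=
  fun p hp hLU k _ _ =>
    hP4 p hp k (cossartPiltant2019_iff.mp h3 k) (localUniformizationUpToDim_of_lurel hLU k 4)

/-- In particular from the barrier file's `ZariskiPatchingUpToDim 4` (all fields).
[cite: CutkoskyMourtada2019, §1] -/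
theorem PatchingRelUpToDim.four_of_zariskiPatchingUpToDim (h3 : CossartPiltant2019.{0})
    (hP4 : ZariskiPatchingUpToDim.{0} 4) : PatchingRelUpToDim 4 :=
  PatchingRelUpToDim.four_of_zariskiPatching h3 fun _ _ k _ _ h3k hLU4 => hP4 k h3k hLU4

/-- More generally every rung follows from the previous one and Zariski patching in that
dimension in characteristic `p` (the induction scheme `resolutionOverUpToDim_all_of_patching`,
with LU supplied by `LUrel_p`). [cite: CutkoskyMourtada2019, §1] -/
theorem PatchingRelUpToDim.succ_of_zariskiPatching {n : ℕ} (hn : PatchingRelUpToDim n)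
    (hP : ∀ p : ℕ, p.Prime → ∀ (k : Type) [Field k] [CharP k p],
      ResolutionOverUpToDim.{0} k n → LocalUniformizationUpToDim.{0} k (n + 1) →
        ResolutionOverUpToDim.{0} k (n + 1)) :
    PatchingRelUpToDim (n + 1) :=
  fun p hp hLU k _ _ => hP p hp k (hn p hp hLU k) (localUniformizationUpToDim_of_lurel hLU k (n + 1))

/-- Rung `4` is, up to the reduction to integral schemes, the strategist's prepared split child
`PatchingRelDimLeFour` (`Cruxes/PatchingRel/SplitChildren.md`, statement verbatim on the right).
[cite: CossartPiltant2019, proof of Prop. 4.6, Step 1 (arXiv v1: Prop. 4.4)] -/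
theorem patchingRelUpToDim_four_iff_dimLeFour :
    PatchingRelUpToDim 4 ↔
      ∀ p : ℕ, p.Prime → (∀ (k K : Type) [Field k] [CharP k p] [Field K] [Algebra k K], (⊤ : IntermediateField k K).FG → ∀ O : ValuationSubring K, (∀ c : k, algebraMap k K c ∈ O) → ∀ R : Subalgebra k K, R.FG → R.toSubring ≤ O.toSubring → ∃ (A : Subalgebra k K) (h : A.toSubring ≤ O.toSubring), R ≤ A ∧ A.FG ∧ IsFractionRing A K ∧ IsRegularLocalRing (Localization.AtPrime (Ideal.comap (Subring.inclusion h) (IsLocalRing.maximalIdeal O)))) → ∀ (k : Type) [Field k] [CharP k p] (X : AlgebraicGeometry.Scheme.{0}) (f : X ⟶ AlgebraicGeometry.Spec (CommRingCat.of k)), AlgebraicGeometry.IsSeparated f → AlgebraicGeometry.LocallyOfFiniteType f → AlgebraicGeometry.QuasiCompact f → AlgebraicGeometry.IsIntegral X → topologicalKrullDim X ≤ 4 → Literature.AlgebraicGeometry.Resolution.Scheme.HasResolution X := by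
  constructor
  · intro h p hp hLU k _ _ X f hs hl hq hint hd
    exact (h p hp hLU k).integral X f hs hl hq hint (by exact_mod_cast hd)
  · intro h p hp hLU k _ _
    refine IntegralResolutionOverUpToDim.resolutionOverUpToDim ?_
    intro X f hs hl hq hint hd
    exact h p hp hLU k X f hs hl hq hint (by exact_mod_cast hd)

/-! ## The skeleton: two registered stubs and the composition -/

/-- **STUB 1 — THE RUNG θ₁ = 4** (`PatchingRelUpToDim 4`, unfolded over tree declarations):
relative local uniformization in characteristic `p` implies weak resolution of reduced separated
schemes of finite type of dimension `≤ 4` over fields of characteristic `p`. Why plausibly true: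
it is implied by the summit and by Zariski patching in dimension `4`; why hard: Piltant's
Prop. 5.1 in transcendence degree `4` needs regular-centre principalization on regular fourfolds
and embedded resolution of threefolds in characteristic `p` (printed open). Size: XL.
[cite: Piltant2013, p. 2, Prop. 5.1 and Problem 7.1] -/
theorem stub_patchingRelUpToDim_four :
    ∀ p : ℕ, p.Prime → (∀ (k K : Type) [Field k] [CharP k p] [Field K] [Algebra k K], (⊤ : IntermediateField k K).FG → ∀ O : ValuationSubring K, (∀ c : k, algebraMap k K c ∈ O) → ∀ R : Subalgebra k K, R.FG → R.toSubring ≤ O.toSubring → ∃ (A : Subalgebra k K) (h : A.toSubring ≤ O.toSubring), R ≤ A ∧ A.FG ∧ IsFractionRing A K ∧ IsRegularLocalRing (Localization.AtPrime (Ideal.comap (Subring.inclusion h) (IsLocalRing.maximalIdeal O)))) → ∀ (k : Type) [Field k] [CharP k p], Literature.AlgebraicGeometry.Resolution.ResolutionOverUpToDim.{0} k 4 := by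
  sorry

/-- **STUB 2 — THE GAP (integral dimension `≥ 5` slice; the further rungs of the same family,
parked)**: verbatim the strategist's `PatchingRelDimGeFive`. Why plausibly true: implied by the
summit; why parked: no dimension-`≥ 5` input exists before rung `4` closes. Size: XXL.
[cite: NovacoskiSpivakovsky2016, §1] -/
theorem stub_patchingRelDimGeFive :
    ∀ p : ℕ, p.Prime → (∀ (k K : Type) [Field k] [CharP k p] [Field K] [Algebra k K], (⊤ : IntermediateField k K).FG → ∀ O : ValuationSubring K, (∀ c : k, algebraMap k K c ∈ O) → ∀ R : Subalgebra k K, R.FG → R.toSubring ≤ O.toSubring → ∃ (A : Subalgebra k K) (h : A.toSubring ≤ O.toSubring), R ≤ A ∧ A.FG ∧ IsFractionRing A K ∧ IsRegularLocalRing (Localization.AtPrime (Ideal.comap (Subring.inclusion h) (IsLocalRing.maximalIdeal O)))) → ∀ (k : Type) [Field k] [CharP k p] (X : AlgebraicGeometry.Scheme.{0}) (f : X ⟶ AlgebraicGeometry.Spec (CommRingCat.of k)), AlgebraicGeometry.IsSeparated f → AlgebraicGeometry.LocallyOfFiniteType f → AlgebraicGeometry.QuasiCompact f → AlgebraicGeometry.IsIntegral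 X → ¬ topologicalKrullDim X ≤ 4 → Literature.AlgebraicGeometry.Resolution.Scheme.HasResolution X := by
  sorry

/-- Stub 1 is rung `4` of the ladder, on the nose. [folklore] -/
theorem stub_patchingRelUpToDim_four_iff :
    (∀ p : ℕ, p.Prime → (∀ (k K : Type) [Field k] [CharP k p] [Field K] [Algebra k K], (⊤ : IntermediateField k K).FG → ∀ O : ValuationSubring K, (∀ c : k, algebraMap k K c ∈ O) → ∀ R : Subalgebra k K, R.FG → R.toSubring ≤ O.toSubring → ∃ (A : Subalgebra k K) (h : A.toSubring ≤ O.toSubring), R ≤ A ∧ A.FG ∧ IsFractionRing A K ∧ IsRegularLocalRing (Localization.AtPrime (Ideal.comap (Subring.inclusion h) (IsLocalRing.maximalIdeal O)))) → ∀ (k : Type) [Field k] [CharP k p], Literature.AlgebraicGeometry.Resolution.ResolutionOverUpToDim.{0} k 4)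
      ↔ PatchingRelUpToDim 4 :=
  Iff.rfl

/-- **THE SKELETON THEOREM `PatchingRel_of`**: the crux from the two registered stubs BY NAME —
reduce `ResolutionInChar p` to integral schemes (`resolutionInChar_iff_integral`) and split on
`topologicalKrullDim X ≤ 4`: the rung (stub 1) below, the gap (stub 2) above. Kernel-checked
wiring; the only `sorry`s of the file sit inside the two `stub_*` declarations it applies.
[cite: CossartPiltant2019, proof of Prop. 4.6, Step 1 (arXiv v1: Prop. 4.4)] -/
theorem PatchingRel_of : Theses.Valuative.PatchingRel := by
  intro p hp hLU
  rw [resolutionInChar_iff_integral]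
  intro k _ _ X f hsep hft hqc hint
  by_cases hd : topologicalKrullDim X ≤ 4
  · exact (stub_patchingRelUpToDim_four p hp hLU k).integral X f hsep hft hqc hint
      (by exact_mod_cast hd)
  · exact stub_patchingRelDimGeFive p hp hLU k X f hsep hft hqc hint hd

/-- **THE COMPOSITION, sorry-free, with the stubs as explicit hypotheses** (`rung → gap → crux`;
the same proof as `PatchingRel_of`). [cite: CossartPiltant2019, proof of Prop. 4.6, Step 1] -/
theorem patchingRel_of_rung_of_gap
    (h4 :∀ p : ℕ, p.Prime → (∀ (k K : Type) [Field k] [CharP k p] [Field K] [Algebra k K], (⊤ : IntermediateField k K).FG → ∀ O : ValuationSubring K, (∀ c : k, algebraMap k K c ∈ O) → ∀ R : Subalgebra k K, R.FG → R.toSubring ≤ O.toSubring → ∃ (A : Subalgebra k K) (h : A.toSubring ≤ O.toSubring), R ≤ A ∧ A.FG ∧ IsFractionRing A K ∧ IsRegularLocalRing (Localization.AtPrime (Ideal.comap (Subring.inclusion h) (IsLocalRing.maximalIdeal O)))) → ∀ (k : Type) [Field k] [CharP k p], Literature.AlgebraicGeometry.Resolution.ResolutionOverUpToDim.{0} k 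4)
    (h5 : ∀ p : ℕ, p.Prime → (∀ (k K : Type) [Field k] [CharP k p] [Field K] [Algebra k K], (⊤ : IntermediateField k K).FG → ∀ O : ValuationSubring K, (∀ c : k, algebraMap k K c ∈ O) → ∀ R : Subalgebra k K, R.FG → R.toSubring ≤ O.toSubring → ∃ (A : Subalgebra k K) (h : A.toSubring ≤ O.toSubring), R ≤ A ∧ A.FG ∧ IsFractionRing A K ∧ IsRegularLocalRing (Localization.AtPrime (Ideal.comap (Subring.inclusion h) (IsLocalRing.maximalIdeal O)))) → ∀ (k : Type) [Field k] [CharP k p] (X : AlgebraicGeometry.Scheme.{0}) (f : X ⟶ AlgebraicGeometry.Spec (CommRingCat.of k)), AlgebraicGeometry.IsSeparated f → AlgebraicGeometry.LocallyOfFiniteType f → AlgebraicGeometry.QuasiCompact f → AlgebraicGeometry.IsIntegral X → ¬ topologicalKrullDim X ≤ 4 → Literature.AlgebraicGeometry.Resolution.Scheme.HasResolution X) :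
    Theses.Valuative.PatchingRel := by
  intro p hp hLU
  rw [resolutionInChar_iff_integral]
  intro k _ _ X f hsep hft hqc hint
  by_cases hd : topologicalKrullDim X ≤ 4
  · exact (h4 p hp hLU k).integral X f hsep hft hqc hint (by exact_mod_cast hd)
  · exact h5 p hp hLU k X f hsep hft hqc hint hd

/-- The two presentations agree: the skeleton theorem is the composition applied to the stubs.
[folklore] -/
theorem patchingRel_of_stubs : Theses.Valuative.PatchingRel :=
  patchingRel_of_rung_of_gap stub_patchingRelUpToDim_four stub_patchingRelDimGeFive

/-- Conversely the crux gives back both stubs: the skeleton loses nothing. [folklore] -/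
theorem stubs_of_patchingRel (h : Theses.Valuative.PatchingRel) :
    PatchingRelUpToDim 4 ∧
      (∀ p : ℕ, p.Prime → LUrel p → ∀ (k : Type) [Field k] [CharP k p]
        (X : AlgebraicGeometry.Scheme.{0}) (f : X ⟶ AlgebraicGeometry.Spec (CommRingCat.of k)),
        AlgebraicGeometry.IsSeparated f → AlgebraicGeometry.LocallyOfFiniteType f →
          AlgebraicGeometry.QuasiCompact f → AlgebraicGeometry.IsIntegral X →
            ¬ topologicalKrullDim X ≤ 4 → Scheme.HasResolution X) :=
  ⟨PatchingRelUpToDim.of_patchingRel h 4, fun p hp hLU k _ _ X f hs hl hq _ _ =>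
    h p hp hLU k X f hs hl hq inferInstance⟩

/-! ## The crux is the limit of the ladder
(placed after the skeleton theorem `PatchingRel_of`, which must be the first declaration of the
file concluding the crux) -/

/-- THE CRUX IS THE LIMIT OF THE LADDER: all rungs together give the crux, because a scheme of
finite type over a field is finite-dimensional. [folklore] -/
theorem patchingRel_of_forall (h : ∀ n, PatchingRelUpToDim n) : Theses.Valuative.PatchingRel := by
  intro p hp hLU k _ _ X f hs hl hq hr
  haveI : QuasiCompact f := hq
  haveI : LocallyOfFiniteType f := hl
  haveI : CompactSpace X := QuasiCompact.compactSpace_of_compactSpace f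
  obtain ⟨d, hd⟩ := exists_topologicalKrullDim_le_of_locallyOfFiniteType f
  exact h d p hp hLU k X f hs hl hq hr hd

/-- The crux is equivalent to the conjunction of its rungs, and (by antitonicity) to the rungs
from `4` on. [folklore] -/
theorem patchingRel_iff_forall :
    Theses.Valuative.PatchingRel ↔ ∀ n, 4 ≤ n → PatchingRelUpToDim n := by
  refine ⟨fun h n _ => PatchingRelUpToDim.of_patchingRel h n, fun h => patchingRel_of_forall ?_⟩
  intro n
  rcases Nat.lt_or_ge n 4 with hlt | hge
  · exact (h 4 le_rfl).mono hlt.le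
  · exact h n hge

end Summit.ResolutionOfSingularities.ResolutionOfSingularities.Cruxes.PatchingRel.DimensionLadder

end
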